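import Literature.Computability.Complexity.XRayMachineLists
import Literature.Computability.Complexity.DiscreteTomographyBridge
import HarnessLib

/-!
# `1-IN-3-SAT ≤ₚ 2D-X-RAY`: discharge of `GGP1999_circuitBoard` and of the tomography leaf
# `GGP1999_twoDXRayNPHard` (Gardner–Gritzmann–Prangenberg 1999, Thm. 3.7)

Assembly of the Karp reduction from ONE-IN-THREE 3SAT (`ONEIN3SAT`, `OneInThreeSAT.lean`) to
2D-X-RAY (`TWODXRAY`, `DiscreteTomographyHardness.lean`): the guarded map

  `toXRayF w = if w is the canonical code of a clause list with three pairwise distinct literals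
   per clause then the code of its 2D-X-RAY instance xrayOf (decCNF w) else badXRay`,

with the guard `goodF` (`XRayMachineIdx.lean`), the output `outF` (`XRayMachineLists.lean`, value
`outF_encode`), correctness `xrayOf_mem_twoDXRaySet_iff` (`OneInThreeSATRename.lean`: the ladder
complex of `OneInThreeSATLadder.lean` over the confinement theorem of
`TomographyCellComplex.lean`) and the fixed inconsistent instance `badXRay = code ([1], [0], [0])`.
Gardner–Gritzmann–Prangenberg prove their Lemma 3.4 ("CONSISTENCY_{𝓕²}(S₁*, S₂*, S₃*) is
NP-complete in the strong sense") by "a transformation from … 1-IN-3-SAT" — the circuit board —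
and conclude Thm. 3.7; here the transformation is the ladder complex (same source problem and
gadgets, arithmetic confinement, see the module docstring of `OneInThreeSATLadder.lean`), proved
correct and polynomial-time in the tree's `FP`:

* `ONEIN3SAT_karpReducible_TWODXRAY : ONEIN3SAT ≤ₚ TWODXRAY`;
* **`GGP1999_circuitBoard_holds`** — discharge of the named fact of `OneInThreeSAT.lean`;
* **`GGP1999_twoDXRayNPHard_holds : IsNPHard TWODXRAY`** — discharge of the tomography leaf of
  `DiscreteTomographyHardness.lean` (with `Schaefer1978_oneInThreeSAT_NPHard_holds`,
  `OneInThreeSATMachine.lean`), and of its twin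
  **`Tomography.GardnerGritzmannPrangenberg1999_twoDXRay_NPHard_holds`** (`DiscreteTomography.lean`,
  via the bridge `DiscreteTomographyBridge.lean`).

After this file the NP-hardness of KRONECKER (`IMW2017_kroneckerNPHard`,
`Barriers/ValiantsHypothesis/KroneckerPositivityHardnessProofs.lean`) rests on the single
machine-level fact `FischerIkenmeyer2020_xrayToKronecker_mem_FP` there.

## References

* [GardnerGritzmannPrangenberg1999] R. J. Gardner, P. Gritzmann, D. Prangenberg, *On the
  computational complexity of reconstructing lattice sets from their X-rays*, Discrete Math. 202
  (1999) 45–71 (held), Lemma 3.4 and its proof, Thm. 3.7.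
* [GardnerGritzmann1999] R. J. Gardner, P. Gritzmann, in: Herman–Kuba (eds.), *Discrete
  Tomography* (1999), Thms. 4.4.3, 4.4.4.
* [FischerIkenmeyer2020] N. Fischer, C. Ikenmeyer, Comput. Complexity 29 (2020) 8, §6 (Problem 5).
* [AroraBarak2009] S. Arora, B. Barak, *Computational Complexity*, CUP 2009, §1.3, Def. 2.7.
-/

noncomputable section

namespace Literature.Computability.Complexity

namespace OneInThree

open _root_.Computability Brick
open Literature.Combinatorics.Enumerative.Tomography
open scoped Notation

/-! ### A fixed inconsistent instance -/

/-- The code of the 2D-X-RAY instance `([1], [0], [0])` (`r = 0`: one point demanded by the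
`X`-marginal, none allowed by the `Y`-marginal). [folklore] -/
def badXRay : List Bool := encodingTwoDXRay.encode ([1], [0], [0])

/-- `([1], [0], [0])` is inconsistent. [folklore] -/
theorem bad_not_mem_twoDXRaySet : (([1], [0], [0]) : List ℕ × List ℕ × List ℕ) ∉ twoDXRaySet := by
  rintro ⟨r, h1, -, -, S, hS, hx, hy, -⟩
  have hr : r = 0 := by simpa using h1
  subst hr
  have hx0 := hx 0
  have hy0 := hy 0
  simp only [List.getD_cons_zero] at hx0 hy0
  obtain ⟨p, hp⟩ : (S.filter fun p => p.1 = 0).Nonempty := by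
    rw [← Finset.card_pos, ← xMarginal_def, hx0]; exact Nat.one_pos
  have hpS := (Finset.mem_filter.1 hp).1
  have hp0 : p.2.1 = 0 := by
    have := mem_layer.1 (hS hpS); unfold csum at this; omega
  have : 0 < yMarginal S 0 := by
    rw [yMarginal_def, Finset.card_pos]; exact ⟨p, Finset.mem_filter.2 ⟨hpS, hp0⟩⟩
  omega

/-- `badXRay ∉ TWODXRAY`. [folklore] -/
theorem badXRay_not_mem : badXRay ∉ TWODXRAY := fun h =>
  bad_not_mem_twoDXRaySet ((encode_mem_TWODXRAY_iff _).1 h)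

/-! ### The reduction on codes -/

/-- **The reduction `1-IN-3-SAT → 2D-X-RAY` on codes**: a canonical code of a clause list with
three pairwise distinct literals per clause is sent to the code of its 2D-X-RAY instance, every
other string to `badXRay`. [cite: GardnerGritzmannPrangenberg1999, Lemma 3.4 (proof)] -/
def toXRayF : List Bool → List Bool := iteFn goodF outF (fun _ => badXRay)

/-- **The reduction is polynomial time.** [cite: AroraBarak2009, §1.3] -/
theorem toXRayF_mem_FP : toXRayF ∈ FP := iteFn_mem_FP goodF_mem_FP outF_mem_FP (const_mem_FP _)

/-- Value on a CNF code. [folklore] -/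
theorem toXRayF_encode (φ : CNF ℕ) :
    toXRayF (encodingCNF.encode φ) =
      if φ.IsThreeLiteralClauses then encodingTwoDXRay.encode (xrayOf φ) else badXRay := by
  rw [toXRayF, iteFn_apply (goodF_encode φ)]
  by_cases h : φ.IsThreeLiteralClauses
  · rw [decide_eq_true h, if_pos rfl, if_pos h, outF_encode h]
  · rw [decide_eq_false h, if_neg Bool.false_ne_true, if_neg h]

/-- Value on a non-code. [folklore] -/
theorem toXRayF_of_not_canon {x : List Bool} (hx : encodingCNF.encode (NegCNF.decCNF x) ≠ x) :
    toXRayF x = badXRay := by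
  rw [toXRayF, iteFn_apply (goodF_of_not_canon hx), if_neg Bool.false_ne_true]

/-- **`ONE-IN-THREE 3SAT ≤ₚ 2D-X-RAY`.** [cite: GardnerGritzmannPrangenberg1999, Lemma 3.4] -/
theorem ONEIN3SAT_karpReducible_TWODXRAY : ONEIN3SAT ≤ₚ TWODXRAY := by
  refine ⟨toXRayF, toXRayF_mem_FP, fun x => ?_⟩
  show x ∈ ONEIN3SAT ↔ toXRayF x ∈ TWODXRAY
  by_cases hx : encodingCNF.encode (NegCNF.decCNF x) = x
  · rw [← hx, toXRayF_encode, mem_ONEIN3SAT_iff]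
    by_cases h3 : (NegCNF.decCNF x).IsThreeLiteralClauses
    · rw [if_pos h3, encode_mem_TWODXRAY_iff, xrayOf_mem_twoDXRaySet_iff h3]
      exact ⟨fun h => h.2, fun h => ⟨h3, h⟩⟩
    · rw [if_neg h3]
      exact ⟨fun h => (h3 h.1).elim, fun h => (badXRay_not_mem h).elim⟩
  · rw [toXRayF_of_not_canon hx]
    exact ⟨fun h => (hx (KSATRed.encode_decCNF_of_mem h)).elim, fun h => (badXRay_not_mem h).elim⟩

end OneInThree

/-! ### Discharges -/

/-- **Discharge of `GGP1999_circuitBoard`** (`OneInThreeSAT.lean`): `ONEIN3SAT ≤ₚ TWODXRAY`, by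
the ladder complex. [cite: GardnerGritzmannPrangenberg1999, Lemma 3.4 (proof: transformation from 1-IN-3-SAT)] -/
theorem GGP1999_circuitBoard_holds : GGP1999_circuitBoard := OneInThree.ONEIN3SAT_karpReducible_TWODXRAY

/-- **Discharge of the tomography leaf `GGP1999_twoDXRayNPHard`** (`DiscreteTomographyHardness.lean`):
2D-X-RAY is NP-hard — ONE-IN-THREE 3SAT is NP-hard (`Schaefer1978_oneInThreeSAT_NPHard_holds`: Cook–Levin,
`SAT ≤ₚ 3SAT`, `3SAT ≤ₚ ONEIN3SAT`, all proved in the tree) and `ONEIN3SAT ≤ₚ TWODXRAY`.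
[cite: GardnerGritzmannPrangenberg1999, Thm. 3.7] [cite: GardnerGritzmann1999, Thm. 4.4.4] -/
theorem GGP1999_twoDXRayNPHard_holds : GGP1999_twoDXRayNPHard :=
  GGP1999_twoDXRayNPHard_of_circuitBoard GGP1999_circuitBoard_holds

/-- **Discharge of the twin leaf `Tomography.GardnerGritzmannPrangenberg1999_twoDXRay_NPHard`**
(`DiscreteTomography.lean`, the plethysm-side copy of 2D-X-RAY; same language by
`TWODXRAY_eq`). [cite: GardnerGritzmannPrangenberg1999, Thm. 3.7] -/
theorem Tomography.GardnerGritzmannPrangenberg1999_twoDXRay_NPHard_holds :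
    Tomography.GardnerGritzmannPrangenberg1999_twoDXRay_NPHard :=
  Tomography.twoDXRay_NPHard_of Schaefer1978_oneInThreeSAT_NPHard_holds GGP1999_circuitBoard_holds

end Literature.Computability.Complexity
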